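import Mathlib
import HarnessLib
import HarnessLib.Audit
import Summits.Schanuel.Statement
import Literature.NumberTheory.Transcendental.ExpVarieties
import Literature.ModelTheory.ExponentialFields.Semialgebraic

/-!
Route: SheetCounting

CLOSED (retired) 2026-08-15T13:51:25Z by operator:999:1257524 — reason: not-a-thesis: assembly does not conclude the sub-problem Statement — note: D-0027 §2.1 audit (human 2026-08-15: routes that do not decide the summit are removed): the assembly concludes `SheetSparsityTwo`, not the sub-problem statement; a NEW conforming route may be opened from the same idea (generated `closes : … → _root_.Schanuel`).. The file is kept as the record of this route; refuted decls are indexed as negative knowledge (`ledger negatives`).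

# Route SheetCounting — Schanuel counts sheets — Wilkie's conjecture (BNZ) makes Schanuel-violating
sheets polylog-sparse, unconditionally shaped at n = 2

Realises card sparse-sheets-wilkie-counting (spine; audit grade new-combination). For an algebraic V
⊆ ℂⁿ × (ℂˣ)ⁿ the SHEET SET is
T_V := {k ∈ ℝⁿ : ∃ x′ with Im x′ᵢ ∈ [0, 2π), (x′ + 2πik, e^{x′}) ∈ V} ⊆ ℝⁿ (window trick: the sheet
index of the multivalued logarithm as a
real parameter entering V polynomially); V ∩ Γⁿ ≠ ∅ iff T_V meets ℤⁿ, and Schanuel ⟺ "no ℚ-variety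
of dimension < n has an integer sheet point
with a ℚ-linearly independent witness" (support SchanuelIffSheets). T_V is existentially definable
from unrestricted real exp and restricted
sin/cos, so Wilkie's conjecture — now the theorem of Binyamini–Novikov–Zak — bounds the integer
points of height ≤ H on its transcendental part
by c_V (log H)^{κ_V} (crux WilkieSheetBound, the unproved-in-tree named fact, filed FIRST), while
the algebraic part T_V^alg is "lower-rank
Schanuel" (Ax on semialgebraic arcs). RUNG ROUTE: it suffices to show, for the unconditional n = 2
layer, X = SheetSparsityTwo: every
geometrically irreducible algebraic curve W ⊆ ℂ² × ℂ² defined over ℚ̄ and not contained in a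
rational hyperplane {q·x = 0} has at most
c_W (log H)^{κ_W} sheets k ∈ ℤ² ∩ [−H, H]² carrying a graph point (x, eˣ) ∈ W (SC(2) predicts: no
sheet carries a ℚ-independent one; square
Khovanskii systems carry ≍ H). The inductive skeleton "SC(<n) ⇒ polylog sparsity of violating sheets
for ℚ̄-varieties of dimension < n"
(crux InductiveSheetSparsity) is the layer above; the assembly stops at X, strictly below
`Schanuel`, and says so.
Lean: `∀ (W : Set (Fin 2 ⊕ Fin 2 → ℂ)), Literature.NumberTheory.Transcendental.IsIrreducibleClosed ℂ
W → Literature.NumberTheory.Transcendental.zariskiDim ℂ W = 1 →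
Literature.NumberTheory.Transcendental.IsDefinedOver (algebraicClosure ℚ ℂ).toSubfield W → (∀ q :
Fin 2 → ℤ, q ≠ 0 → ∃ p ∈ W, ∑ i, (q i : ℂ) * p (Sum.inl i) ≠ 0) → ∃ (c : ℝ) (κ : ℕ), ∀ H : ℕ, 3 ≤ H
→ ∃ s : Finset (Fin 2 → ℤ), (s.card : ℝ) ≤ c * Real.log H ^ κ ∧ ∀ k : Fin 2 → ℤ, (∀ i, |k i| ≤ (H :
ℤ)) → (∃ x' : Fin 2 → ℂ, (∀ i, 0 ≤ (x' i).im ∧ (x' i).im < 2 * Real.pi) ∧ Sum.elim (fun i => x' i +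
2 * (Real.pi : ℂ) * Complex.I * (k i : ℂ)) (fun i => Complex.exp (x' i)) ∈ W) → k ∈ s`

## Assembly
Glue with real content, provable once its three hypotheses are granted (difficulty M; it is the
kernel-checkable form of "T2 modulo BNZ"):
fix W as in SheetSparsityTwo and take (c₁, κ₁) from WilkieSheetBound for n = 2, V = W. If T_W
contains no infinite connected semialgebraic
set, every sheet lies in T_W^trans and the bound is c₁ (log H)^κ₁. Otherwise SheetArcDichotomy
applies. Degenerate case q·x ≡ κ on W:
κ is algebraic (W has a Zariski-dense set of ℚ̄-points) and κ ≠ 0 by hypothesis, a graph point would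
give y^q = e^κ transcendental
(Hermite–Lindemann, tree transcendental_exp_holds) whereas y^q is algebraic on a dense subset of the
irreducible W, so W ∩ Γ lies in a proper
closed subset of W and is finite: finitely many sheets, absorbed in c. Constant case W = C × {y₀}:
y₀ is algebraic, C is an irreducible
ℚ̄-curve which is not a rational line through 0 (else W ⊆ {q·x = 0}), the only witness is x′ = the
window logarithm of y₀, and the sheets are
a translate of the lattice set of BranchLatticeFinite: finite again. Hence SheetSparsityTwo with c =
c₁ + #(exceptional sheets), κ = κ₁.
HONEST CEILING: X is a quantitative shadow of SC(2) (polylog where SC predicts zero and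
RigidCore/ModulusFirst want finiteness); the link
to `Schanuel` is the dictionary SchanuelIffSheets and the conditional skeleton
InductiveSheetSparsity, not an implication X → Schanuel.

Rationale: WHY THIS LINE. Mechanism: count BRANCHES, not heights — a Schanuel counterexample on V is an integer
point of the definable set T_V ⊆ ℝⁿ of dimension
≤ 2 dim V − n, so the strongest unconditional theorem of o-minimal point counting, Wilkie's
conjecture (BinyaminiNovikovZak2024 =
arXiv:2202.05305, Thm 1 for restricted sub-Pfaffian sets with constants depending only on format and
degree, Cor 1 for ℝ_exp by the
M-truncation Y_M = Y ∩ [−M, M]^N, read on p. 3), applies verbatim to the truncations of T_V and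
gives polylog sparsity of violating sheets;
the algebraic part is removed by Ax1971 (tree theorem ax_schanuel_holds) on semialgebraic arcs,
which for curves forces y constant or a
rational linear degeneracy (crux SheetArcDichotomy), and the finite-y-projection residue dies by a
transporter argument using only
Lindemann1882 / Hermite–Lindemann (tree transcendental_pi_holds, transcendental_exp_holds; support
BranchLatticeFinite). Imported area:
tame geometry / Pfaffian point counting (PilaWilkie2006, Pila 2007 doi:10.5802/afst.1162,
Jones–Thomas doi:10.1093/qmath/har011,
Pila2022 Ch. 10, BNZ) joined to functional transcendence (Ax) and linear transcendence at proved
strength. What it does that prior routes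
do not: RigidCore (stmt-Schanuel-0971 SparsityTwo) and ModulusFirst (FinitenessTwo,
UnitaryAxisFiniteness) want FINITENESS at n = 2,
open exactly on the unitary-symmetric / Shapiro atoms (DaquinoMacintyreTerzo2014); this line proves
POLYLOG SPARSITY there with a
different input, for all curves off {q·x = 0} at once, and localises the whole arithmetic content of
SC(n) given SC(<n) to the gap
"polylog → 0" on the transcendental part of one definable set per variety. Negatives index: empty at
filing.

RANKED CRUXES. #0 SheetSparsityTwo (target) — for every geometrically irreducible algebraic curve W
⊆ ℂ² × ℂ² defined over ℚ̄ with W ⊄ {q·x = 0} for all q ∈ ℤ² ∖ 0, there are c, κ with: for H ≥ 3 the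
sheets k ∈ ℤ², |kᵢ| ≤ H, admitting a window witness x′ (Im x′ᵢ ∈ [0,2π), (x′ + 2πik, e^{x′}) ∈ W)
number ≤ c (log H)^κ (card C1/T2 in sheet form; the point form is support PointSparsityTwo). (why it
might fail: Only through its inputs: if T_W ∩ [−H,H]² is not uniformly of bounded Pfaffian format
(WilkieSheetBound) the bound degrades to H^ε (PilaWilkie2006), or a third family of semialgebraic
arcs (SheetArcDichotomy) carries ≫ (log H)^κ sheets.) [BinyaminiNovikovZak2024, arXiv:2202.05305,
PilaWilkie2006, doi:10.5802/aif.2530, DaquinoMacintyreTerzo2014]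
#2 WilkieSheetBound (crux) — the BNZ input in the exact shape consumed (filed FIRST because it is
the one unproved-in-tree named fact the line rests on): for every n and every Zariski-closed V ⊆ ℂⁿ
× ℂⁿ there are c, κ such that for H ≥ 3 the integer points k, |kᵢ| ≤ H, of T_V not lying on any
infinite connected semialgebraic subset of T_V (i.e. in T_V^trans, BNZ's X ∖ X^alg) number ≤ c (log
H)^κ. Specialisation of BinyaminiNovikovZak2024 Thm 1 via Cor 1's truncation: S = {(u, θ, k) : P_j(u
+ iθ + 2πik, e^u(cos θ + i sin θ)) = 0, θ ∈ [0,2π)} is quantifier-free in e^{u_i}, sin θ_i, cos θ_i;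
S_M := S ∩ {|u| ≤ M} is restricted semi-Pfaffian of format/degree independent of M; X_M := π_k(S_M)
↑ T_V and X_M ∖ T_V^alg ⊆ X_M^trans, so the finitely many integer points of a box are covered by one
M. For n = 2 (dim T_W ≤ 1) already Pila 2007 / Jones–Thomas 2012 / Butler 2012 (1-dimensional sets
existentially definable in ℝ_Pfaff). [difficulty: XL] (why it might fail: BNZ Thm 1 is for
restricted sub-Pfaffian sets; T_V mixes UNRESTRICTED e^{Re x′} with restricted sin/cos of Im x′, so
the claim rests on the truncation having (F,D) independent of M (Cor 1's device, p.3) — a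
format-bookkeeping step nobody has written out; plus XL to formalise.) [BinyaminiNovikovZak2024,
arXiv:2202.05305, PilaWilkie2006, doi:10.5802/afst.1162, doi:10.1093/qmath/har011, Pila2022,
Khovanskii1991]
#3 SheetArcDichotomy (crux) — algebraic part of the sheet set of a curve: if W ⊆ ℂ² × ℂ² is a
geometrically irreducible algebraic curve and T_W contains an infinite connected semialgebraic set,
then either y is constant on W (W = C × {y₀}) or W is degenerate (q·x ≡ κ on W for some q ∈ ℤ² ∖ 0).
Proof plan: curve selection gives a Nash arc k(s) in T_W and an analytic family of witnesses x′(s);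
trdeg_ℂ ℂ(x′, e^{x′}) ≤ dim W + 1 = 2 < 3, so Ax (tree ax_schanuel_holds, one derivation) gives q·x′
≡ c′, hence y^q ≡ α on W; in adapted coordinates a non-vertical arc makes log y^r algebraic along
the arc, so d log y^r is exact on a finite cover and y^r, hence y, is constant; a vertical arc makes
q·k, hence q·x, constant on W ("T_W^alg = lower-rank Schanuel" at n = 2; the case x constant is
degenerate). [difficulty: L] (why it might fail: Lifting a semialgebraic arc of T_W to an ANALYTIC
family of window witnesses needs semialgebraic curve selection + a local analytic section of the
witness correspondence (no ℝ_an,exp o-minimality in tree); a witness family hopping branches at the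
window edge Im x′ = 0 could hide a third case.) [Ax1971, Kirby2010EAEF, BochnakCosteRoy1998,
doi:10.5802/aif.2530, Marker2006]
#4 InductiveSheetSparsity (crux) — the inductive skeleton (card C2 / T_n): for every n, Schanuel in
all ranks r < n (inlined SchanuelRank) implies that for every Zariski-closed V ⊆ ℂⁿ × ℂⁿ defined
over ℚ̄ with zariskiDim V < n, the sheets k ∈ ℤⁿ ∩ [−H,H]ⁿ admitting a window witness x′ with x′ +
2πik ℚ-linearly independent number ≤ c_V (log H)^{κ_V} for H ≥ 3. At n = 2 it follows from
SheetSparsityTwo (SC(1) = Hermite–Lindemann; components inside {q·x = 0} carry only dependent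
points); from n = 3 on it is conditional on SchanuelTwo and its content is the algebraic part in
higher dimension: along a semialgebraic arc Ax gives one relation q·x′ ≡ c′, the problem descends to
the coset {y^q = α} ≅ a 𝔾^{n−1}-situation, overdetermined again unless a FROZEN ℚ-independent
sub-tuple violates SC(n−1). [deps: WilkieSheetBound, SheetArcDichotomy] [difficulty: open-problem]
(why it might fail: For n ≥ 3 Ax yields one relation per arc but the arc's Zariski closure V′ ⊊ V
may carry a moving ℚ-span of dimension ≥ 2 with a frozen independent sub-tuple; SC(<n) bounds trdeg,
not the NUMBER of such sheets, so T_V^alg ∩ ℤⁿ may exceed (log H)^κ.) [Ax1971, Kirby2010EAEF,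
BinyaminiNovikovZak2024, Waldschmidt2000, Lang1966]
#9 BranchLatticeFinite (support) — lattice lemma for the finite-y-projection residue (provable now
from Lindemann + Hermite–Lindemann only): if C ⊆ ℂ² is a geometrically irreducible curve over ℚ̄
which is not a line through 0 of rational slope, and α₁, α₂ are non-zero algebraic numbers, then {k
∈ ℤ² : (Log α₁ + 2πik₁, Log α₂ + 2πik₂) ∈ C} is finite. Proof: if infinite, C′ := A⁻¹(C) with A(k) =
Log α + 2πik is the Zariski closure of integer points, hence a ℚ̄-curve; the transporter {g ∈ 𝔾_a² ⋊
𝔾_m : gC′ = C} is ℚ̄-closed and contains (Log α, 2πi), so it is positive-dimensional (else 2πi ∈ ℚ̄,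
Lindemann), so C′ and C are lines; C = {a·x = c} over ℚ̄ with infinitely many lattice solutions
forces a rational direction and a₁ Log α₁ + a₂ Log α₂ + 2πim = c ∈ ℚ̄, so e^c ∈ ℚ̄ and c = 0
(Hermite–Lindemann), i.e. C is a rational line through 0. Generalises RigidCore's
One/TwoLogsBranchRelationFinite (different hypotheses, shared proof ideas). [difficulty: M]
[Lindemann1882, BakerTNT1975, Literature.NumberTheory.Transcendental.transcendental_pi_holds,
Literature.NumberTheory.Transcendental.transcendental_exp_holds]
#9 SheetFibreBound (support) — uniformly finitely many window witnesses per sheet: for a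
geometrically irreducible curve W ⊆ ℂ² × ℂ² there is N with #{x′ : Im x′ᵢ ∈ [0,2π), (x′ + 2πik,
e^{x′}) ∈ W} ≤ N for every real k (graph points of the translates W − (2πik, 0) in one window).
Reduces, by projecting to a non-constant coordinate pair (xᵢ, yᵢ), to "an exponential polynomial
Σ_{j≤d} p_j(w) e^{jw}, deg p_j ≤ d, has ≤ N(d) zeros in any horizontal strip of height 2π"
(Khovanskii fewnomial bound for the chain (e^u, restricted tan), or Pólya–Tijdeman zero geometry
doi:10.1016/s1385-7258(71)80003-3); discreteness of graph points on a curve is Ax. Glue from sheets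
to points; the tree's Khovanskii theorem is exp-only, so not provable-now as filed. [difficulty: L]
[Khovanskii1991, doi:10.1016/s1385-7258(71)80003-3, Ax1971,
Literature.ModelTheory.ExponentialFields.Khovanskii.exists_forall_encard_components_zeroSetR_le]
#9 PointSparsityTwo (support) — the card's C1 verbatim (point form): for W as in SheetSparsityTwo,
#{x ∈ ℂ² : (x, eˣ) ∈ W, ‖Im x‖_∞ ≤ 2πH} ≤ c_W (log H)^{κ_W} for H ≥ 3 — "overdetermined exponential
systems over ℚ̄ in two unknowns have polylog many solutions of imaginary height ≤ H", against ≍ H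
for square systems. Immediate from SheetSparsityTwo + SheetFibreBound (a point of imaginary height ≤
2πH sits on a sheet with |kᵢ| ≤ H + 1). [difficulty: M] [BinyaminiNovikovZak2024, Khovanskii1991,
doi:10.5802/aif.2530]
#9 SchanuelIffSheets (support) — the dictionary (card S1): Schanuel ⟺ for every n and every
Zariski-closed V ⊆ ℂⁿ × ℂⁿ defined over ℚ with zariskiDim V < n, no integer sheet k has a window
witness x′ with x′ + 2πik ℚ-linearly independent. (⇐: the ℚ-Zariski closure of (z, e^z) has
dimension trdeg ℚ(z, e^z); ⇒: a point of a ℚ-variety of dimension d has trdeg ≤ d.) Bookkeeping over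
Mathlib + ExpVarieties; the dimension-equals-trdeg lemma is shared with RigidCore's
MinimalCounterexampleInAcl / SparsityTwo. [difficulty: M] [Kirby2010EAEF, Marker2006, Lang1966,
Waldschmidt2000]
#9 FixedPointPairsDiagonal (support) — the card's DAO(ii), an unlikely-intersection lemma for card
tight-tuples-relative-hl-fixed-points: the only geometrically irreducible curve C ⊆ ℂ² defined over
ℚ̄ containing infinitely many PAIRS of fixed points of exp (e^z = z, e^w = w) is the diagonal. Plan:
fixed points satisfy Re z = log|z|, z_k = log(2π|k|) + i(2πk + π/2·sgn k) + O(log|k|/|k|); along a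
branch of C at infinity w ~ a z^μ the modulus identity forces μ = 1, a real, then the argument
identity and "2πim ∉ ℚ̄" force a = 1 and the branch to be the diagonal. Not in the assembly.
[difficulty: L] [DaquinoMacintyreTerzo2014, Marker2006, Lindemann1882]

TWO-LAYER PLAN. Foreseen glued splits (none filed now; k ≤ 3, depth 1): WilkieSheetBound ⇐
SheetSetFormat (T_V ∩ [−H,H]ⁿ = ⋃_M π(S_M) with S_M restricted
semi-Pfaffian of (F, D) independent of M) → BNZTheoremOne (Thm 1 of arXiv:2202.05305 as a Literature
named fact over a minimal
restricted-sub-Pfaffian vocabulary) → WilkieSheetBound. SheetArcDichotomy ⇐ ArcLift (an infinite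
connected semialgebraic A ⊆ T_W contains
a Nash arc carrying an analytic family of window witnesses) → AxOnArc (q·x′ ≡ c′ along it, hence y^q
≡ α on W) → SheetArcDichotomy.
InductiveSheetSparsity ⇐ LevelTwo (from SheetSparsityTwo + decomposition into ℚ̄-components) →
FrozenMovingLemma (n ≥ 3: arcs of T_V
descend to cosets y^q = α where SC(<n) leaves finitely many frozen configurations) →
InductiveSheetSparsity.

KILL CRITERIA. WilkieSheetBound refuted (a Zariski-closed V whose sheet set has ≫ (log H)^κ
transcendental integer points) = either BNZ misread or the
format claim false: restate every counting item with H^ε (PilaWilkie2006 needs no format) — the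
route survives weakened, grade drops.
SheetArcDichotomy refuted by a third family of semialgebraic arcs: restate with that family if it
carries finitely many sheets over ℚ̄,
else close `refuted:SheetArcDichotomy` (then SheetSparsityTwo itself is in doubt). SheetSparsityTwo
refuted outright (an irreducible
ℚ̄-curve off {q·x = 0} with more than polylog many sheets) closes the route and is a theorem about
BNZ's scope worth having.
InductiveSheetSparsity refuted at some n ≥ 3 (with SC(<n) as hypothesis it can only be refuted by
exhibiting the leak in T_V^alg): drop it,
the n = 2 rung stands. Mooted: SparsityTwo (stmt-Schanuel-0971) or FinitenessTwo
(stmt-Schanuel-4146) proved ⇒ the target is superseded at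
n = 2 (finiteness beats polylog) but WilkieSheetBound / InductiveSheetSparsity / the supports stand;
SchanuelTwo (stmt-Schanuel-0069)
proved moots the n = 2 layer entirely.

NOT DECOMPOSED YET. The format lemma behind WilkieSheetBound (restricted-sub-Pfaffian vocabulary,
*-format of BNZ §3) and BNZ Thm 1 as a Literature fact —
layer 2. Semialgebraic curve selection / analytic witness sections for SheetArcDichotomy
(BochnakCosteRoy1998 §2.5; no ℝ_an,exp
o-minimality in tree: wilkie_isOMinimal is itself undischarged). The trig-Pfaffian Khovanskii or
Pólya–Tijdeman strip count behind
SheetFibreBound. The n ≥ 3 algebraic part (frozen/moving bookkeeping) of InductiveSheetSparsity. The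
card's DAO(i) (pairs of zeros of
f, g ∈ ℚ̄[e^z]: Bézout on the period lattice + Baker) and DAO(iii) (general f, g ∈ ℚ̄[z, e^z],
irrational algebraic slope with two 1/k
tails — Shapiro-type, arXiv:1206.6747) are not items. Explicit κ (Pila 2007 gives explicit exponents
for Pfaff curves; BNZ's poly_F(D, ·)
is unspecified). The certified enumeration N1 (T_W ∩ ℤ² ∩ [−10⁶, 10⁶]² for the unitary-symmetric
benchmark W = {x₂ = √2 x₁, y₁ =
(1+x₁)/(1−x₁), y₂ = (2+x₁)/(2−x₁)} by root isolation of one real equation per k₁) is evidence for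
refuters/idle provers (kit), attachable
to SheetSparsityTwo and to EclCore's NotSchanuel item, not an item. Definition items sheetSet /
algPart to replace the inlined set-builders.

CHEAPEST FALSIFIER. (1) A one-hour format audit of BNZ §3 (arXiv:2202.05305, *-format and *-degree
of ℝ_rPfaff formulas): is S_M = {(u, θ, k) : |u| ≤ M,
θ ∈ [0, 2π), P_j(u + iθ + 2πik, e^u(cos θ + i sin θ)) = 0} in Ω_{F,D} with (F, D) independent of M,
sin/cos on [0, 2π] entering through a
bounded number of tan(θ/2)-charts? The novelty audit (refuter-novelty-audit-12) checked it
informally and agreed; a NO degrades every count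
to H^ε. (2) The benchmark enumeration N1 above: SheetSparsityTwo predicts O((log H)^κ) sheets up to
H = 10⁶ (in truth probably O(1)); growth
like H^δ refutes the target numerically and would contradict BNZ, so it doubles as a consistency
check. Not run this session (plancard
one-shot, no kit in payload). (3) Literature: an existing "overdetermined exponential systems have
polylog many solutions in a box" theorem
would make the target `known` — searched (card, audit, this session: hybrid/galaxy/crossref), none
found; nearest Pila AIF 2010.

NUMBERS. Pila AIF 60 (2010) doi:10.5802/aif.2530 Thm 1.6: N(Z^trans, T) ≤ c (log T)^45 for Z = {log
x log y = log z} (Pila2022 Thm 10.5; Z^alg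
computed by Ax–Schanuel, §4). Pila 2007 doi:10.5802/afst.1162: explicit (log H)^γ for Pfaff curves,
γ depending on order and degree of
the chain. Jones–Thomas doi:10.1093/qmath/har011: Wilkie's conjecture for 1-dimensional sets
existentially definable in ℝ_Pfaff and for
ℝ_resPfaff surfaces (Pila2022 Thm 10.4, 10.6). BNZ Thm 1: #X^trans(g, H) ≤ poly_F(D, g, log H),
degree of the polynomial unspecified.
Square Khovanskii systems in two unknowns: ≍ H graph points of imaginary height ≤ H (one per period
strip per branch); SC(2) predicts 0
independent ones on every overdetermined ℚ̄-curve. Khovanskii's real bound shape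
2^{q(q−1)/2}(d+1)^{O(k)} (Khovanskii1991 Ch. III).
Items at open: 10 (1 target, 3 cruxes, 5 supports, 1 assembly).

DEFINITION REQUESTS. None filed at open: the sheet set T_V, its algebraic part (via the tree's
Literature.ModelTheory.ExponentialFields.IsSemialgebraic, all of
whose named facts are discharged: tarski_seidenberg(_real)_holds) and the window are inlined
set-builders over Mathlib +
Literature.NumberTheory.Transcendental.ExpVarieties (companion facts discharged). Foreseen:
definition items `sheetSet` / `algPart` under
Summits/Schanuel/Schanuel/Theorems once provers ask; a cite item "fact: BinyaminiNovikovZak2024 Thm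
1 / Cor 1 (Wilkie's conjecture for
restricted sub-Pfaffian structures and ℝ_exp)" under Literature/ModelTheory/ExponentialFields as the
landing place of WilkieSheetBound's split.

Novelty: Searches (2026-08-15, this planner): `lit search --hybrid "Wilkie conjecture rational points
transcendental part exponential algebraic surface
polylogarithmic"` (10 held docs; Pila2022 pp. 94–97 READ: Conj 10.1, Thm 10.4–10.7, the announced
proof [558] = BNZ); `lit read
arXiv:2202.05305` p. 3 (Thm 1, Cor 1 and the M-truncation proof, verbatim); `lit galaxy search
"exponential-algebraic surface" --star all`
(1 row: Pila2022); `lit galaxy search --star pdf --mode bm25 "polylogarithmic bound rational points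
transcendental part graph of
exponentiation overdetermined exponential system Schanuel conjecture"` (10 rows:
D'Aquino–Macintyre–Terzo Schanuel Nullstellensatz,
Edmundo–Terzo, noise); crossref lookups for Pila 2007 (doi:10.5802/afst.1162), Jones–Thomas
(doi:10.1093/qmath/har011), van den
Dries–Miller (doi:10.1007/bf02758635), Tijdeman 1971 (doi:10.1016/s1385-7258(71)80003-3);
searchd/zbMATH graph re-rank DOWN (connection
reset) — plus the card's logged searches (frontier rows arXiv:2301.09883, arXiv:2604.15189; pool
greps) and the audit's zbMATH reads.
Nearest prior art found: doi:10.5802/aif.2530 (Pila, AIF 60 (2010): polylog rational points on the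
exponential-algebraic surface log x
log y = log z, Z^alg by Ax–Schanuel — the printed instance of "counting as an unconditional shadow
of an SC consequence"; it counts
rational POINTS of a surface, not sheets of an overdetermined intersection); BinyaminiNovikovZak2024
/ arXiv:2202.05305 (the tool);
Kirby2010EAEF Prop 7.2 (countere  [refs: 10.5802/afst.1162, 10.1093/qmath/har011, 10.1007/bf02758635, 10.1016/s1385-7258(71, 10.5802/aif.2530, 2202.05305, 2301.09883, 2604.15189, doi:10.5802/afst.1162, doi:10.1093/qmath/har011, doi:10.1007/bf02758635, doi:10.1016/s1385-7258, doi:10.5802/aif.2530, Pila2022, BinyaminiNovikovZak2024]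

Barriers (technique_class: o-minimal-counting, wilkie-conjecture, ax-schanuel): - technique_class: o-minimal-counting, wilkie-conjecture, ax-schanuel
- Literature.Barriers.Schanuel.AxSchanuelFunctionalNotNumerical: respected, not evaded — Ax is used
only functionally, to classify the positive-dimensional (semialgebraic) part of T_W; the numerical
content of SC(2) is quarantined in the gap "polylog → 0" on T_W^trans, which the route does not
claim; the bet is that polylog sparsity is the strongest unconditional statement available there and
worth having kernel-checked modulo BNZ.
- Literature.Barriers.Schanuel.AlgebraicIndependenceOfLogarithms: not engaged — no transcendence
method runs; Lindemann / Hermite–Lindemann enter at proved strength (tree transcendental_pi_holds,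
transcendental_exp_holds) in BranchLatticeFinite and the assembly; Baker is not even needed.
- Literature.Barriers.Schanuel.LargeTranscendenceDegree: other technique class (no auxiliary
functions, no measure of linear independence); n/a.
- Literature.Barriers.Schanuel.LinearSubgroupMethodLimit: n/a — no linear subgroup theorem or
matrices of logarithms.
- Literature.Barriers.Schanuel.AxiomsDoNotForceSchanuel: n/a — no Zilber axioms, categoricity or
quasiminimality; archimedean counting is precisely the input Bays–Kirby's homogeneous fields lack.
- Literature.Barriers.Schanuel.SchanuelPropertyNotFirstOrder: consistent — every item is about the
one structure (ℝ, exp, sin|[0,2π]) / (ℂ, exp) with the standard kernel; nothing is axiomatised or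
transferred.
- Literature.Barriers.Schanuel.Neste

History (route lifecycle, newest last):
- 2026-08-15T13:51:25Z · CLOSED retired — not-a-thesis: assembly does not conclude the sub-problem Statement (operator:999:1257524)

sub-problem: Schanuel · status: closed(retired) · opened planner-plancard-Schanuel-Schanuel-sparse-she-6c39614c-0 2026-08-15T12:19:30Z · rev 0 · ledger route-Schanuel-SheetCounting
GENERATED by the gate from the ledger (D-0016/17). Provers cite these decls: `theorem foo : Summit.Schanuel.Schanuel.Theses.SheetCounting.<Decl> := …` in Summits/Schanuel/Schanuel/Theorems/<Name>.lean.
-/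

namespace Summit.Schanuel.Schanuel.Theses.SheetCounting

open scoped BigOperators Topology Manifold Classical MeasureTheory ProbabilityTheory Matrix InnerProductSpace ComplexConjugate ContinuousMap
open Filter Set Function TopologicalSpace MeasureTheory

attribute [summit_statement] _root_.Schanuel

open Literature.Periods

/-- item stmt-Schanuel-7874 · target · rank 0 · closed · moot by None · by planner
why it might fail: Only through its inputs: if T_W ∩ [−H,H]² is not uniformly of bounded Pfaffian format (WilkieSheetBound) the bound degrades to H^ε (PilaWilkie2006), or a third family of semialgebraic arcs (SheetArcDichotomy) carries ≫ (log H)^κ sheets.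
sources: BinyaminiNovikovZak2024, arXiv:2202.05305, PilaWilkie2006, doi:10.5802/aif.2530, DaquinoMacintyreTerzo2014
[target] for every geometrically irreducible algebraic curve W ⊆ ℂ² × ℂ² defined over ℚ̄ with W ⊄
{q·x = 0} for all q ∈ ℤ² ∖ 0, there are c, κ with: for H ≥ 3 the sheets k ∈ ℤ², |kᵢ| ≤ H, admitting
a window witness x′ (Im x′ᵢ ∈ [0,2π), (x′ + 2πik, e^{x′}) ∈ W) number ≤ c (log H)^κ (card C1/T2 in
sheet form; the point form is support PointSparsityTwo). -/
@[route_item "route-Schanuel-SheetCounting"]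
def SheetSparsityTwo : Prop :=
  ∀ (W : Set (Fin 2 ⊕ Fin 2 → ℂ)), Literature.NumberTheory.Transcendental.IsIrreducibleClosed ℂ W → Literature.NumberTheory.Transcendental.zariskiDim ℂ W = 1 → Literature.NumberTheory.Transcendental.IsDefinedOver (algebraicClosure ℚ ℂ).toSubfield W → (∀ q : Fin 2 → ℤ, q ≠ 0 → ∃ p ∈ W, ∑ i, (q i : ℂ) * p (Sum.inl i) ≠ 0) → ∃ (c : ℝ) (κ : ℕ), ∀ H : ℕ, 3 ≤ H → ∃ s : Finset (Fin 2 → ℤ), (s.card : ℝ) ≤ c * Real.log H ^ κ ∧ ∀ k : Fin 2 → ℤ, (∀ i, |k i| ≤ (H : ℤ)) → (∃ x' : Fin 2 → ℂ, (∀ i, 0 ≤ (x' i).im ∧ (x' i).im < 2 * Real.pi) ∧ Sum.elim (fun i => x' i + 2 * (Real.pi : ℂ) * Complex.I * (k i : ℂ)) (fun i => Complex.exp (x' i)) ∈ W) → k ∈ s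

/-- item stmt-Schanuel-7875 · crux · rank 2 · closed · moot by None · by planner
why it might fail: BNZ Thm 1 is for restricted sub-Pfaffian sets; T_V mixes UNRESTRICTED e^{Re x′} with restricted sin/cos of Im x′, so the claim rests on the truncation having (F,D) independent of M (Cor 1's device, p.3) — a format-bookkeeping step nobody has written out; plus XL to formalise.
sources: BinyaminiNovikovZak2024, arXiv:2202.05305, PilaWilkie2006, doi:10.5802/afst.1162, doi:10.1093/qmath/har011, Pila2022
[crux] the BNZ input in the exact shape consumed (filed FIRST because it is the one unproved-in-tree
named fact the line rests on): for every n and every Zariski-closed V ⊆ ℂⁿ × ℂⁿ there are c, κ such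
that for H ≥ 3 the integer points k, |kᵢ| ≤ H, of T_V not lying on any infinite connected
semialgebraic subset of T_V (i.e. in T_V^trans, BNZ's X ∖ X^alg) number ≤ c (log H)^κ.
Specialisation of BinyaminiNovikovZak2024 Thm 1 via Cor 1's truncation: S = {(u, θ, k) : P_j(u + iθ
+ 2πik, e^u(cos θ + i sin θ)) = 0, θ ∈ [0,2π)} is quantifier-free in e^{u_i}, sin θ_i, cos θ_i; S_M
:= S ∩ {|u| ≤ M} is restricted semi-Pfaffian of format/degree independent of M; X_M := π_k(S_M) ↑
T_V and X_M ∖ T_V^alg ⊆ X_M^trans, so the finitely many integer points of a box are covered by one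
M. For n = 2 (dim T_W ≤ 1) already Pila 2007 / Jones–Thomas 2012 / Butler 2012 (1-dimensional sets
existentially definable in ℝ_Pfaff). [difficulty: XL] -/
@[route_item "route-Schanuel-SheetCounting"]
def WilkieSheetBound : Prop :=
  ∀ (n : ℕ) (V : Set (Fin n ⊕ Fin n → ℂ)), Literature.NumberTheory.Transcendental.IsZariskiClosed ℂ V → ∃ (c : ℝ) (κ : ℕ), ∀ H : ℕ, 3 ≤ H → ∃ s : Finset (Fin n → ℤ), (s.card : ℝ) ≤ c * Real.log H ^ κ ∧ ∀ k : Fin n → ℤ, (∀ i, |k i| ≤ (H : ℤ)) → (∃ x' : Fin n → ℂ, (∀ i, 0 ≤ (x' i).im ∧ (x' i).im < 2 * Real.pi) ∧ Sum.elim (fun i => x' i + 2 * (Real.pi : ℂ) * Complex.I * (k i : ℂ)) (fun i => Complex.exp (x' i)) ∈ V) → (¬ ∃ A : Set (Fin n → ℝ), (fun i => (k i : ℝ)) ∈ A ∧ Literature.ModelTheory.ExponentialFields.IsSemialgebraic ℝ A ∧ IsConnected A ∧ A.Infinite ∧ A ⊆ {t : Fin n → ℝ | ∃ x' : Fin n →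 ℂ, (∀ i, 0 ≤ (x' i).im ∧ (x' i).im < 2 * Real.pi) ∧ Sum.elim (fun i => x' i + 2 * (Real.pi : ℂ) * Complex.I * ((t i : ℝ) : ℂ)) (fun i => Complex.exp (x' i)) ∈ V}) → k ∈ s

/-- item stmt-Schanuel-7876 · crux · rank 3 · closed · moot by None · by planner
why it might fail: Lifting a semialgebraic arc of T_W to an ANALYTIC family of window witnesses needs semialgebraic curve selection + a local analytic section of the witness correspondence (no ℝ_an,exp o-minimality in tree); a witness family hopping branches at the window edge Im x′ = 0 could hide a third case.
sources: Ax1971, Kirby2010EAEF, BochnakCosteRoy1998, doi:10.5802/aif.2530, Marker2006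
[crux] algebraic part of the sheet set of a curve: if W ⊆ ℂ² × ℂ² is a geometrically irreducible
algebraic curve and T_W contains an infinite connected semialgebraic set, then either y is constant
on W (W = C × {y₀}) or W is degenerate (q·x ≡ κ on W for some q ∈ ℤ² ∖ 0). Proof plan: curve
selection gives a Nash arc k(s) in T_W and an analytic family of witnesses x′(s); trdeg_ℂ ℂ(x′,
e^{x′}) ≤ dim W + 1 = 2 < 3, so Ax (tree ax_schanuel_holds, one derivation) gives q·x′ ≡ c′, hence
y^q ≡ α on W; in adapted coordinates a non-vertical arc makes log y^r algebraic along the arc, so d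
log y^r is exact on a finite cover and y^r, hence y, is constant; a vertical arc makes q·k, hence
q·x, constant on W ("T_W^alg = lower-rank Schanuel" at n = 2; the case x constant is degenerate).
[difficulty: L] -/
@[route_item "route-Schanuel-SheetCounting"]
def SheetArcDichotomy : Prop :=
  ∀ (W : Set (Fin 2 ⊕ Fin 2 → ℂ)), Literature.NumberTheory.Transcendental.IsIrreducibleClosed ℂ W → Literature.NumberTheory.Transcendental.zariskiDim ℂ W = 1 → (∃ A : Set (Fin 2 → ℝ), Literature.ModelTheory.ExponentialFields.IsSemialgebraic ℝ A ∧ IsConnected A ∧ A.Infinite ∧ A ⊆ {t : Fin 2 → ℝ | ∃ x' : Fin 2 → ℂ, (∀ i, 0 ≤ (x' i).im ∧ (x' i).im < 2 * Real.pi) ∧ Sum.elim (fun i => x' i + 2 * (Real.pi : ℂ) * Complex.I * ((t i : ℝ) : ℂ)) (fun i => Complex.exp (x' i)) ∈ W}) → (∃ y₀ : Fin 2 → ℂ, ∀ p ∈ W, ∀ i, p (Sum.inr i) = y₀ i) ∨ (∃ q : Fin 2 → ℤ, q ≠ 0 ∧ ∃ κ : ℂ, ∀ p ∈ W, ∑ i,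 (q i : ℂ) * p (Sum.inl i) = κ)

/-- item stmt-Schanuel-7877 · crux · rank 4 · closed · moot by None · by planner
why it might fail: For n ≥ 3 Ax yields one relation per arc but the arc's Zariski closure V′ ⊊ V may carry a moving ℚ-span of dimension ≥ 2 with a frozen independent sub-tuple; SC(<n) bounds trdeg, not the NUMBER of such sheets, so T_V^alg ∩ ℤⁿ may exceed (log H)^κ.
sources: Ax1971, Kirby2010EAEF, BinyaminiNovikovZak2024, Waldschmidt2000, Lang1966
[crux] the inductive skeleton (card C2 / T_n): for every n, Schanuel in all ranks r < n (inlined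
SchanuelRank) implies that for every Zariski-closed V ⊆ ℂⁿ × ℂⁿ defined over ℚ̄ with zariskiDim V <
n, the sheets k ∈ ℤⁿ ∩ [−H,H]ⁿ admitting a window witness x′ with x′ + 2πik ℚ-linearly independent
number ≤ c_V (log H)^{κ_V} for H ≥ 3. At n = 2 it follows from SheetSparsityTwo (SC(1) =
Hermite–Lindemann; components inside {q·x = 0} carry only dependent points); from n = 3 on it is
conditional on SchanuelTwo and its content is the algebraic part in higher dimension: along a
semialgebraic arc Ax gives one relation q·x′ ≡ c′, the problem descends to the coset {y^q = α} ≅ a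
𝔾^{n−1}-situation, overdetermined again unless a FROZEN ℚ-independent sub-tuple violates SC(n−1).
[deps: WilkieSheetBound, SheetArcDichotomy] [difficulty: open-problem] -/
@[route_item "route-Schanuel-SheetCounting"]
def InductiveSheetSparsity : Prop :=
  ∀ n : ℕ, (∀ r < n, ∀ y : Fin r → ℂ, LinearIndependent ℚ y → (r : Cardinal) ≤ Algebra.trdeg ℚ ↥(IntermediateField.adjoin ℚ (Set.range y ∪ Set.range (Complex.exp ∘ y)))) → ∀ (V : Set (Fin n ⊕ Fin n → ℂ)), Literature.NumberTheory.Transcendental.IsDefinedOver (algebraicClosure ℚ ℂ).toSubfield V → Literature.NumberTheory.Transcendental.zariskiDim ℂ V < (n : WithBot ℕ∞) → ∃ (c : ℝ) (κ : ℕ), ∀ H : ℕ, 3 ≤ H → ∃ s : Finset (Fin n → ℤ), (s.card : ℝ) ≤ c * Real.log H ^ κ ∧ ∀ k : Fin n → ℤ, (∀ i, |k i| ≤ (H : ℤ)) → (∃ x' : Fin n → ℂ, (∀ i, 0 ≤ (x' i).im ∧ (x' i).im < 2 * Real.pi) ∧ LinearIndependent ℚ (fun i => x' i + 2 * (Real.pi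 : ℂ) * Complex.I * (k i : ℂ)) ∧ Sum.elim (fun i => x' i + 2 * (Real.pi : ℂ) * Complex.I * (k i : ℂ)) (fun i => Complex.exp (x' i)) ∈ V) → k ∈ s

/-- item stmt-Schanuel-7878 · support · rank 9 · closed · moot by None · by planner
sources: Lindemann1882, BakerTNT1975, Literature.NumberTheory.Transcendental.transcendental_pi_holds, Literature.NumberTheory.Transcendental.transcendental_exp_holds
[support] lattice lemma for the finite-y-projection residue (provable now from Lindemann +
Hermite–Lindemann only): if C ⊆ ℂ² is a geometrically irreducible curve over ℚ̄ which is not a line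
through 0 of rational slope, and α₁, α₂ are non-zero algebraic numbers, then {k ∈ ℤ² : (Log α₁ +
2πik₁, Log α₂ + 2πik₂) ∈ C} is finite. Proof: if infinite, C′ := A⁻¹(C) with A(k) = Log α + 2πik is
the Zariski closure of integer points, hence a ℚ̄-curve; the transporter {g ∈ 𝔾_a² ⋊ 𝔾_m : gC′ = C}
is ℚ̄-closed and contains (Log α, 2πi), so it is positive-dimensional (else 2πi ∈ ℚ̄, Lindemann), so
C′ and C are lines; C = {a·x = c} over ℚ̄ with infinitely many lattice solutions forces a rational
direction and a₁ Log α₁ + a₂ Log α₂ + 2πim = c ∈ ℚ̄, so e^c ∈ ℚ̄ and c = 0 (Hermite–Lindemann), i.e.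
C is a rational line through 0. Generalises RigidCore's One/TwoLogsBranchRelationFinite (different
hypotheses, shared proof ideas). [difficulty: M] -/
@[route_item "route-Schanuel-SheetCounting"]
def BranchLatticeFinite : Prop :=
  ∀ (C : Set (Fin 2 → ℂ)), Literature.NumberTheory.Transcendental.IsIrreducibleClosed ℂ C → Literature.NumberTheory.Transcendental.zariskiDim ℂ C = 1 → Literature.NumberTheory.Transcendental.IsDefinedOver (algebraicClosure ℚ ℂ).toSubfield C → (∀ q : Fin 2 → ℤ, q ≠ 0 → ∃ p ∈ C, ∑ i, (q i : ℂ) * p i ≠ 0) → ∀ α : Fin 2 → ℂ, (∀ i, IsAlgebraic ℚ (α i) ∧ α i ≠ 0) → Set.Finite {k : Fin 2 → ℤ | (fun i => Complex.log (α i) + 2 * (Real.pi : ℂ) * Complex.I * (k i : ℂ)) ∈ C}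

/-- item stmt-Schanuel-7879 · support · rank 9 · closed · moot by None · by planner
sources: Khovanskii1991, doi:10.1016/s1385-7258(71)80003-3, Ax1971, Literature.ModelTheory.ExponentialFields.Khovanskii.exists_forall_encard_components_zeroSetR_le
[support] uniformly finitely many window witnesses per sheet: for a geometrically irreducible curve
W ⊆ ℂ² × ℂ² there is N with #{x′ : Im x′ᵢ ∈ [0,2π), (x′ + 2πik, e^{x′}) ∈ W} ≤ N for every real k
(graph points of the translates W − (2πik, 0) in one window). Reduces, by projecting to a
non-constant coordinate pair (xᵢ, yᵢ), to "an exponential polynomial Σ_{j≤d} p_j(w) e^{jw}, deg p_j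
≤ d, has ≤ N(d) zeros in any horizontal strip of height 2π" (Khovanskii fewnomial bound for the
chain (e^u, restricted tan), or Pólya–Tijdeman zero geometry doi:10.1016/s1385-7258(71)80003-3);
discreteness of graph points on a curve is Ax. Glue from sheets to points; the tree's Khovanskii
theorem is exp-only, so not provable-now as filed. [difficulty: L] -/
@[route_item "route-Schanuel-SheetCounting"]
def SheetFibreBound : Prop :=
  ∀ (W : Set (Fin 2 ⊕ Fin 2 → ℂ)), Literature.NumberTheory.Transcendental.IsIrreducibleClosed ℂ W → Literature.NumberTheory.Transcendental.zariskiDim ℂ W = 1 → ∃ N : ℕ, ∀ k : Fin 2 → ℝ, {x' : Fin 2 → ℂ | (∀ i, 0 ≤ (x' i).im ∧ (x' i).im < 2 * Real.pi) ∧ Sum.elim (fun i => x' i + 2 * (Real.pi : ℂ) * Complex.I * ((k i : ℝ) : ℂ)) (fun i => Complex.exp (x' i)) ∈ W}.encard ≤ N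

/-- item stmt-Schanuel-7880 · support · rank 9 · closed · moot by None · by planner
sources: BinyaminiNovikovZak2024, Khovanskii1991, doi:10.5802/aif.2530
[support] the card's C1 verbatim (point form): for W as in SheetSparsityTwo, #{x ∈ ℂ² : (x, eˣ) ∈ W,
‖Im x‖_∞ ≤ 2πH} ≤ c_W (log H)^{κ_W} for H ≥ 3 — "overdetermined exponential systems over ℚ̄ in two
unknowns have polylog many solutions of imaginary height ≤ H", against ≍ H for square systems.
Immediate from SheetSparsityTwo + SheetFibreBound (a point of imaginary height ≤ 2πH sits on a sheet
with |kᵢ| ≤ H + 1). [difficulty: M] -/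
@[route_item "route-Schanuel-SheetCounting"]
def PointSparsityTwo : Prop :=
  ∀ (W : Set (Fin 2 ⊕ Fin 2 → ℂ)), Literature.NumberTheory.Transcendental.IsIrreducibleClosed ℂ W → Literature.NumberTheory.Transcendental.zariskiDim ℂ W = 1 → Literature.NumberTheory.Transcendental.IsDefinedOver (algebraicClosure ℚ ℂ).toSubfield W → (∀ q : Fin 2 → ℤ, q ≠ 0 → ∃ p ∈ W, ∑ i, (q i : ℂ) * p (Sum.inl i) ≠ 0) → ∃ (c : ℝ) (κ : ℕ), ∀ H : ℕ, 3 ≤ H → ∃ s : Finset (Fin 2 → ℂ), (s.card : ℝ) ≤ c * Real.log H ^ κ ∧ ∀ x : Fin 2 → ℂ, Sum.elim x (Complex.exp ∘ x) ∈ W → (∀ i, |(x i).im| ≤ 2 * Real.pi * H) → x ∈ s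

/-- item stmt-Schanuel-7881 · support · rank 9 · closed · moot by None · by planner
sources: Kirby2010EAEF, Marker2006, Lang1966, Waldschmidt2000
[support] the dictionary (card S1): Schanuel ⟺ for every n and every Zariski-closed V ⊆ ℂⁿ × ℂⁿ
defined over ℚ with zariskiDim V < n, no integer sheet k has a window witness x′ with x′ + 2πik
ℚ-linearly independent. (⇐: the ℚ-Zariski closure of (z, e^z) has dimension trdeg ℚ(z, e^z); ⇒: a
point of a ℚ-variety of dimension d has trdeg ≤ d.) Bookkeeping over Mathlib + ExpVarieties; the
dimension-equals-trdeg lemma is shared with RigidCore's MinimalCounterexampleInAcl / SparsityTwo.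
[difficulty: M] -/
@[route_item "route-Schanuel-SheetCounting"]
def SchanuelIffSheets : Prop :=
  Schanuel ↔ ∀ (n : ℕ) (V : Set (Fin n ⊕ Fin n → ℂ)), Literature.NumberTheory.Transcendental.IsDefinedOver (⊥ : Subfield ℂ) V → Literature.NumberTheory.Transcendental.zariskiDim ℂ V < (n : WithBot ℕ∞) → ∀ (k : Fin n → ℤ) (x' : Fin n → ℂ), (∀ i, 0 ≤ (x' i).im ∧ (x' i).im < 2 * Real.pi) → Sum.elim (fun i => x' i + 2 * (Real.pi : ℂ) * Complex.I * (k i : ℂ)) (fun i => Complex.exp (x' i)) ∈ V → ¬ LinearIndependent ℚ (fun i => x' i + 2 * (Real.pi : ℂ) * Complex.I * (k i : ℂ))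

/-- item stmt-Schanuel-7882 · support · rank 9 · closed · moot by None · by planner
sources: DaquinoMacintyreTerzo2014, Marker2006, Lindemann1882
[support] the card's DAO(ii), an unlikely-intersection lemma for card
tight-tuples-relative-hl-fixed-points: the only geometrically irreducible curve C ⊆ ℂ² defined over
ℚ̄ containing infinitely many PAIRS of fixed points of exp (e^z = z, e^w = w) is the diagonal. Plan:
fixed points satisfy Re z = log|z|, z_k = log(2π|k|) + i(2πk + π/2·sgn k) + O(log|k|/|k|); along a
branch of C at infinity w ~ a z^μ the modulus identity forces μ = 1, a real, then the argument
identity and "2πim ∉ ℚ̄" force a = 1 and the branch to be the diagonal. Not in the assembly.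
[difficulty: L] -/
@[route_item "route-Schanuel-SheetCounting"]
def FixedPointPairsDiagonal : Prop :=
  ∀ (C : Set (Fin 2 → ℂ)), Literature.NumberTheory.Transcendental.IsIrreducibleClosed ℂ C → Literature.NumberTheory.Transcendental.zariskiDim ℂ C = 1 → Literature.NumberTheory.Transcendental.IsDefinedOver (algebraicClosure ℚ ℂ).toSubfield C → Set.Infinite {p : Fin 2 → ℂ | p ∈ C ∧ Complex.exp (p 0) = p 0 ∧ Complex.exp (p 1) = p 1} → C = {p : Fin 2 → ℂ | p 0 = p 1}

/-- item stmt-Schanuel-7883 · assembly · rank 1 · closed · moot by None · by planner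
sources: BinyaminiNovikovZak2024, Ax1971, Lindemann1882, Kirby2010EAEF
[assembly] WilkieSheetBound → SheetArcDichotomy → BranchLatticeFinite → SheetSparsityTwo (rung
assembly; the target is strictly below the summit and linked to `Schanuel` only through
SchanuelIffSheets / InductiveSheetSparsity). -/
@[route_item "route-Schanuel-SheetCounting"]
def Assembly : Prop :=
  WilkieSheetBound → SheetArcDichotomy → BranchLatticeFinite → SheetSparsityTwo

end Summit.Schanuel.Schanuel.Theses.SheetCounting
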